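import Literature.NumberTheory.EllipticCurves.ShintaniThetaInversion
import Literature.NumberTheory.EllipticCurves.HalfIntegralWeightThetaMultiplier
import HarnessLib

/-!
# Generalized Shintani theta kernels on the level-`64` lattice

[[cite: Shintani1975, §1–§2, Prop. 1.6, (2.12)]] — the theta kernels
`𝒦[c,t](w, z) = (Im z)^{1/2} ∑_{k ∈ ℤ³} c(k) f_{w, t z}(ι♮ k)` built from Shintani's Schwartz
function `f_{w,Z}(x) = x(w,1) e(Re Z · disc x + i Im Z · majorant_w x)` (tree:
`ShintaniSchwartzFourier`, `ShintaniThetaInversion`) on the level-`64` coefficient lattice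
`ι♮ k = (64k₀, 128k₁, k₂)` with a bounded weight `c`.  This file is the analytic/bookkeeping layer
of the level-`64` Shintani lift used for the Waldspurger-type relation behind
`tunnell_converse_even` (route K64):

* homogeneity / oddness / `SL₂`-equivariance of `disc`, `majorant`, `formEval`, `f_{w,Z}`
  (`shintaniFn_sl_smul`: weight `-2` in `w`, Shintani (2.12));
* the lattice maps `latSharp`, `embedSharp`, the coordinate action `actSharp` of `Γ₀(64)` and its
  inverse (`actSharpEquiv`);
* absolute convergence (`summable_term`) from the tree's decay estimate, the `w`-law
  `genKernel_sl_smul`, real translations in `z` (`genKernel_vadd`, integrality of periods) and the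
  oddness identity `(1 + s) 𝒦 = 0` for weights with `c(-k) = s c(k)`;
* Poisson summation for `f_{w,Z}` over `diag(μ) ℤ³ + h` (`tsum_shintaniFn_diag`), from the tree's
  Poisson formula on `ℤ³` and `Shintani.fourier_shintaniFn`.

Everything is proved; no facts are introduced.
-/

noncomputable section

open Complex Real
open scoped MatrixGroups

namespace Literature.NumberTheory.EllipticCurves.Shintani

open UpperHalfPlane hiding I

/-! ### Elementary transformations of the Schwartz function -/

/-- `f_{w, t +ᵥ z}(x) = e(t · disc x) · f_{w,z}(x)` for real `t`. [folklore] -/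
theorem shintaniFn_vadd (w z : ℍ) (t : ℝ) (x : V) :
    shintaniFn w (t +ᵥ z) x = cexp (2 * π * I * (t * disc x)) * shintaniFn w z x := by
  unfold shintaniFn
  have hre : (((t +ᵥ z : ℍ) : ℂ).re : ℂ) = t + ((z : ℂ).re : ℂ) := by
    rw [UpperHalfPlane.coe_vadd]; simp
  have him : (((t +ᵥ z : ℍ) : ℂ).im : ℂ) = ((z : ℂ).im : ℂ) := by
    rw [UpperHalfPlane.coe_vadd]; simp
  rw [hre, him]
  conv_rhs => rw [mul_left_comm, ← Complex.exp_add]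
  congr 2
  ring

/-- Scaling a point of `ℍ` by a positive real. [folklore] -/
def mulPos (t : ℝ) (ht : 0 < t) (z : ℍ) : ℍ :=
  ⟨t * z, by simpa [Complex.mul_im] using mul_pos ht z.im_pos⟩

/-- `coe_mulPos` (auxiliary). [folklore] -/
@[simp] theorem coe_mulPos (t : ℝ) (ht : 0 < t) (z : ℍ) : (mulPos t ht z : ℂ) = t * z := rfl

/-- `mulPos_re` (auxiliary). [folklore] -/
theorem mulPos_re (t : ℝ) (ht : 0 < t) (z : ℍ) : ((mulPos t ht z : ℍ) : ℂ).re = t * (z : ℂ).re := by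
  simp [Complex.mul_re]

/-- `mulPos_im` (auxiliary). [folklore] -/
theorem mulPos_im (t : ℝ) (ht : 0 < t) (z : ℍ) : ((mulPos t ht z : ℍ) : ℂ).im = t * (z : ℂ).im := by
  simp [Complex.mul_im]

/-- `im_mulPos` (auxiliary). [folklore] -/
theorem im_mulPos (t : ℝ) (ht : 0 < t) (z : ℍ) : (mulPos t ht z).im = t * z.im :=
  mulPos_im t ht z

/-- `mulPos s (mulPos t z) = mulPos (s t) z`. [folklore] -/
theorem mulPos_mulPos (s t : ℝ) (hs : 0 < s) (ht : 0 < t) (z : ℍ) :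
    mulPos s hs (mulPos t ht z) = mulPos (s * t) (mul_pos hs ht) z := by
  apply UpperHalfPlane.ext
  simp only [coe_mulPos]
  push_cast
  ring

/-- `smul_apply_V` (auxiliary). [folklore] -/
@[simp] theorem smul_apply_V (c : ℝ) (x : V) (i : Fin 3) : (c • x) i = c * x i := by simp

/-- `neg_apply_V` (auxiliary). [folklore] -/
@[simp] theorem neg_apply_V (x : V) (i : Fin 3) : (-x) i = -x i := by simp

/-- `disc_smul` (auxiliary). [folklore] -/
theorem disc_smul (c : ℝ) (x : V) : disc (c • x) = c ^ 2 * disc x := by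
  simp only [disc, smul_apply_V]; ring

/-- `pw_smul` (auxiliary). [folklore] -/
theorem pw_smul (w : ℍ) (c : ℝ) (x : V) : pw w (c • x) = c * pw w x := by
  simp only [pw, smul_apply_V]; ring

/-- `majorant_smul` (auxiliary). [folklore] -/
theorem majorant_smul (w : ℍ) (c : ℝ) (x : V) : majorant w (c • x) = c ^ 2 * majorant w x := by
  simp only [majorant, disc_smul, pw_smul]; ring

/-- `formEval_smul` (auxiliary). [folklore] -/
theorem formEval_smul (c : ℝ) (x : V) (u : ℂ) :
    formEval (c • x) u = c * formEval x u := by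
  simp only [formEval, smul_apply_V]; push_cast; ring

/-- Homogeneity: `f_{w,z}(c x) = c · f_{w, c² z}(x)` for `c > 0`. [folklore] -/
theorem shintaniFn_smul (w z : ℍ) {c : ℝ} (hc : 0 < c) (x : V) :
    shintaniFn w z (c • x) = c * shintaniFn w (mulPos (c ^ 2) (by positivity) z) x := by
  unfold shintaniFn
  rw [formEval_smul, disc_smul, majorant_smul, mulPos_re, mulPos_im, mul_assoc]
  congr 2
  push_cast
  ring

/-- `disc_neg` (auxiliary). [folklore] -/
theorem disc_neg (x : V) : disc (-x) = disc x := by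
  simp only [disc, neg_apply_V]; ring

/-- `pw_neg` (auxiliary). [folklore] -/
theorem pw_neg (w : ℍ) (x : V) : pw w (-x) = -pw w x := by
  simp only [pw, neg_apply_V]; ring

/-- `majorant_neg` (auxiliary). [folklore] -/
theorem majorant_neg (w : ℍ) (x : V) : majorant w (-x) = majorant w x := by
  simp only [majorant, disc_neg, pw_neg]; ring

/-- `formEval_neg` (auxiliary). [folklore] -/
theorem formEval_neg (x : V) (u : ℂ) : formEval (-x) u = -formEval x u := by
  simp only [formEval, neg_apply_V]; push_cast; ring

/-- Oddness: `f_{w,z}(-x) = -f_{w,z}(x)`. [folklore] -/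
theorem shintaniFn_neg (w z : ℍ) (x : V) : shintaniFn w z (-x) = -shintaniFn w z x := by
  unfold shintaniFn
  rw [formEval_neg, disc_neg, majorant_neg, neg_mul]

/-! ### The action of `SL₂` on coefficient vectors -/

/-- `x ∘ g` for a binary form `x = [x₀, x₁, x₂]` and `g = (a b; c d)`:
`(x ∘ g)(X, Y) = x(aX + bY, cX + dY)`. [folklore] -/
def actV (a b c d : ℝ) (x : V) : V :=
  !₂[x 0 * a ^ 2 + x 1 * a * c + x 2 * c ^ 2,
     2 * x 0 * a * b + x 1 * (a * d + b * c) + 2 * x 2 * c * d,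
     x 0 * b ^ 2 + x 1 * b * d + x 2 * d ^ 2]

/-- `actV_zero` (auxiliary). [folklore] -/
@[simp] theorem actV_zero (a b c d : ℝ) (x : V) :
    actV a b c d x 0 = x 0 * a ^ 2 + x 1 * a * c + x 2 * c ^ 2 := by simp [actV]
/-- `actV_one` (auxiliary). [folklore] -/
@[simp] theorem actV_one (a b c d : ℝ) (x : V) :
    actV a b c d x 1 = 2 * x 0 * a * b + x 1 * (a * d + b * c) + 2 * x 2 * c * d := by simp [actV]
/-- `actV_two` (auxiliary). [folklore] -/
@[simp] theorem actV_two (a b c d : ℝ) (x : V) :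
    actV a b c d x 2 = x 0 * b ^ 2 + x 1 * b * d + x 2 * d ^ 2 := by simp [actV]

/-- `disc (x ∘ g) = (det g)² disc x`. [folklore] -/
theorem disc_actV (a b c d : ℝ) (x : V) :
    disc (actV a b c d x) = (a * d - b * c) ^ 2 * disc x := by
  simp only [disc, actV_zero, actV_one, actV_two]; ring

/-- `(x ∘ g)(u, 1) = (cu + d)² · x(gu, 1)` in the form `x((au+b)/(cu+d), 1) (cu+d)² = (x∘g)(u,1)`. [folklore] -/
theorem formEval_actV (a b c d : ℝ) (x : V) {u : ℂ} (hu : (c : ℂ) * u + d ≠ 0) :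
    formEval (actV a b c d x) u = ((c : ℂ) * u + d) ^ 2 * formEval x ((a * u + b) / (c * u + d)) := by
  simp only [formEval, actV_zero, actV_one, actV_two]
  push_cast
  field_simp
  ring


/-! ### The `w`-law: `f_{g·w, z}(x) = (cw + d)⁻² f_{w,z}(x ∘ g)` -/

/-- Polarised value `x(w, w̄) = x₀|w|² + x₁ Re w + x₂` transported by `g`:
`x₀|aw+b|² + x₁ Re((aw+b)(c w̄+d)) + x₂|cw+d|² = (x∘g)(w, w̄)`. [folklore] -/
theorem polar_actV (a b c d : ℝ) (x : V) (w : ℂ) :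
    x 0 * Complex.normSq (a * w + b) + x 1 * ((a * w + b) * (starRingEnd ℂ) (c * w + d)).re +
        x 2 * Complex.normSq (c * w + d) =
      actV a b c d x 0 * Complex.normSq w + actV a b c d x 1 * w.re + actV a b c d x 2 := by
  simp only [actV_zero, actV_one, actV_two, Complex.normSq_apply, Complex.mul_re, Complex.mul_im,
    Complex.add_re, Complex.add_im, Complex.ofReal_re, Complex.ofReal_im, Complex.conj_re,
    Complex.conj_im]
  ring

/-- `|cw + d|² · Im((aw+b)/(cw+d)) = (ad - bc) Im w`. [folklore] -/
theorem normSq_mul_im_moebius (a b c d : ℝ) {w : ℂ} (hw : (c : ℂ) * w + d ≠ 0) :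
    Complex.normSq ((c : ℂ) * w + d) * (((a : ℂ) * w + b) / ((c : ℂ) * w + d)).im =
      (a * d - b * c) * w.im := by
  rw [Complex.div_im]
  have hn : Complex.normSq ((c : ℂ) * w + d) ≠ 0 := by rwa [Ne, Complex.normSq_eq_zero]
  field_simp
  simp only [Complex.mul_re, Complex.mul_im, Complex.add_re, Complex.add_im, Complex.ofReal_re,
    Complex.ofReal_im]
  ring

/-- `|cw+d|² · |(aw+b)/(cw+d)|² = |aw+b|²` and the real part analogue, packaged:
`|cw+d|² (x₀ |W|² + x₁ Re W + x₂) = x₀|aw+b|² + x₁Re((aw+b)(c w̄ + d)) + x₂|cw+d|²`, `W = (aw+b)/(cw+d)`.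
[folklore] -/
theorem normSq_mul_polar_moebius (a b c d : ℝ) (x : V) {w : ℂ} (hw : (c : ℂ) * w + d ≠ 0) :
    Complex.normSq ((c : ℂ) * w + d) *
        (x 0 * Complex.normSq (((a : ℂ) * w + b) / ((c : ℂ) * w + d)) +
          x 1 * (((a : ℂ) * w + b) / ((c : ℂ) * w + d)).re + x 2) =
      x 0 * Complex.normSq (a * w + b) + x 1 * ((a * w + b) * (starRingEnd ℂ) (c * w + d)).re +
        x 2 * Complex.normSq (c * w + d) := by
  have hn : Complex.normSq ((c : ℂ) * w + d) ≠ 0 := by rwa [Ne, Complex.normSq_eq_zero]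
  have h1 : Complex.normSq ((c : ℂ) * w + d) * Complex.normSq (((a : ℂ) * w + b) / ((c : ℂ) * w + d)) =
      Complex.normSq ((a : ℂ) * w + b) := by
    rw [Complex.normSq_div]; field_simp
  have h2 : Complex.normSq ((c : ℂ) * w + d) * (((a : ℂ) * w + b) / ((c : ℂ) * w + d)).re =
      (((a : ℂ) * w + b) * (starRingEnd ℂ) ((c : ℂ) * w + d)).re := by
    rw [Complex.div_re, Complex.mul_re, Complex.conj_re, Complex.conj_im]
    field_simp
    ring
  linear_combination x 0 * h1 + x 1 * h2

open Literature.NumberTheory.EllipticCurves.ModularForms (coe_smul_eq' det_eq_one') in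
/-- **`p_{g w}(x) = p_w(x ∘ g)`** for `g ∈ SL₂(ℤ)`. [folklore] -/
theorem pw_sl_smul (g : SL(2, ℤ)) (w : ℍ) (x : V) :
    pw (g • w) x = pw w (actV (g 0 0 : ℤ) (g 0 1 : ℤ) (g 1 0 : ℤ) (g 1 1 : ℤ) x) := by
  have hden : ((g 1 0 : ℤ) : ℂ) * (w : ℂ) + ((g 1 1 : ℤ) : ℂ) ≠ 0 := by
    have := UpperHalfPlane.denom_ne_zero (g : GL (Fin 2) ℝ) w
    rwa [ModularGroup.denom_apply] at this
  have hdet : ((g 0 0 : ℤ) : ℝ) * (g 1 1 : ℤ) - (g 0 1 : ℤ) * (g 1 0 : ℤ) = 1 := by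
    exact_mod_cast det_eq_one' g
  have hre : (g • w).re = ((g • w : ℍ) : ℂ).re := rfl
  have him : (g • w).im = ((g • w : ℍ) : ℂ).im := rfl
  have hwre : w.re = (w : ℂ).re := rfl
  have hwim : w.im = (w : ℂ).im := rfl
  rw [pw, pw, hre, him, coe_smul_eq' g w, hwre, hwim]
  have hden' : (((g 1 0 : ℤ) : ℝ) : ℂ) * (w : ℂ) + (((g 1 1 : ℤ) : ℝ) : ℂ) ≠ 0 := by
    push_cast; exact hden
  have key := normSq_mul_polar_moebius ((g 0 0 : ℤ) : ℝ) ((g 0 1 : ℤ) : ℝ) ((g 1 0 : ℤ) : ℝ)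
    ((g 1 1 : ℤ) : ℝ) x hden'
  have key2 := normSq_mul_im_moebius ((g 0 0 : ℤ) : ℝ) ((g 0 1 : ℤ) : ℝ) ((g 1 0 : ℤ) : ℝ)
    ((g 1 1 : ℤ) : ℝ) hden'
  rw [hdet, one_mul] at key2
  rw [polar_actV] at key
  set W : ℂ := ((((g 0 0 : ℤ) : ℝ) : ℂ) * (w : ℂ) + (((g 0 1 : ℤ) : ℝ) : ℂ)) /
    ((((g 1 0 : ℤ) : ℝ) : ℂ) * (w : ℂ) + (((g 1 1 : ℤ) : ℝ) : ℂ)) with hW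
  set Nd : ℝ := Complex.normSq ((((g 1 0 : ℤ) : ℝ) : ℂ) * (w : ℂ) + (((g 1 1 : ℤ) : ℝ) : ℂ)) with hNd
  have hwim0 : (w : ℂ).im ≠ 0 := w.im_ne_zero
  have hWim : W.im ≠ 0 := by
    intro h0
    rw [h0, mul_zero] at key2
    exact hwim0 key2.symm
  have hW' : ((((g 0 0 : ℤ) : ℂ)) * (w : ℂ) + ((g 0 1 : ℤ) : ℂ)) /
      (((g 1 0 : ℤ) : ℂ) * (w : ℂ) + ((g 1 1 : ℤ) : ℂ)) = W := by
    rw [hW]; push_cast; rfl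
  rw [hW', div_eq_div_iff hWim hwim0]
  calc (x 0 * Complex.normSq W + x 1 * W.re + x 2) * (w : ℂ).im
      = (x 0 * Complex.normSq W + x 1 * W.re + x 2) * (Nd * W.im) := by rw [key2]
    _ = Nd * (x 0 * Complex.normSq W + x 1 * W.re + x 2) * W.im := by ring
    _ = _ := by rw [key]

open Literature.NumberTheory.EllipticCurves.ModularForms (coe_smul_eq' det_eq_one') in
/-- **`q⁺_{g w}(x) = q⁺_w(x ∘ g)`** for `g ∈ SL₂(ℤ)`. [folklore] -/
theorem majorant_sl_smul (g : SL(2, ℤ)) (w : ℍ) (x : V) :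
    majorant (g • w) x = majorant w (actV (g 0 0 : ℤ) (g 0 1 : ℤ) (g 1 0 : ℤ) (g 1 1 : ℤ) x) := by
  have hdet : ((g 0 0 : ℤ) : ℝ) * (g 1 1 : ℤ) - (g 0 1 : ℤ) * (g 1 0 : ℤ) = 1 := by
    exact_mod_cast det_eq_one' g
  rw [majorant, majorant, pw_sl_smul, disc_actV, hdet, one_pow, one_mul]

/-- The denominator `c w + d` of `g ∈ SL₂(ℤ)` at `w`. [folklore] -/
theorem sl_denom_ne_zero (g : SL(2, ℤ)) (w : ℍ) :
    ((g 1 0 : ℤ) : ℂ) * (w : ℂ) + ((g 1 1 : ℤ) : ℂ) ≠ 0 := by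
  have := UpperHalfPlane.denom_ne_zero (g : GL (Fin 2) ℝ) w
  rwa [ModularGroup.denom_apply] at this

open Literature.NumberTheory.EllipticCurves.ModularForms (coe_smul_eq' det_eq_one') in
/-- **`x(g w, 1) · (c w + d)² = (x ∘ g)(w, 1)`** for `g ∈ SL₂(ℤ)`. [folklore] -/
theorem formEval_sl_smul (g : SL(2, ℤ)) (w : ℍ) (x : V) :
    formEval (actV (g 0 0 : ℤ) (g 0 1 : ℤ) (g 1 0 : ℤ) (g 1 1 : ℤ) x) w =
      (((g 1 0 : ℤ) : ℂ) * w + ((g 1 1 : ℤ) : ℂ)) ^ 2 * formEval x ((g • w : ℍ) : ℂ) := by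
  rw [coe_smul_eq' g w]
  have h := formEval_actV ((g 0 0 : ℤ) : ℝ) ((g 0 1 : ℤ) : ℝ) ((g 1 0 : ℤ) : ℝ) ((g 1 1 : ℤ) : ℝ) x
    (u := (w : ℂ)) (by push_cast; exact sl_denom_ne_zero g w)
  push_cast at h ⊢
  exact h

/-- **The `w`-law of the Schwartz function**: `f_{g w, z}(x) · (c w + d)² = f_{w,z}(x ∘ g)` for
`g = (a b; c d) ∈ SL₂(ℤ)` — weight `-2` in `w` (Shintani 1975, (2.12)). [cite: Shintani1975, (2.12)] -/
theorem shintaniFn_sl_smul (g : SL(2, ℤ)) (w z : ℍ) (x : V) :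
    shintaniFn w z (actV (g 0 0 : ℤ) (g 0 1 : ℤ) (g 1 0 : ℤ) (g 1 1 : ℤ) x) =
      (((g 1 0 : ℤ) : ℂ) * w + ((g 1 1 : ℤ) : ℂ)) ^ 2 * shintaniFn (g • w) z x := by
  unfold shintaniFn
  rw [formEval_sl_smul, majorant_sl_smul, disc_actV]
  have hdet : ((g 0 0 : ℤ) : ℝ) * (g 1 1 : ℤ) - (g 0 1 : ℤ) * (g 1 0 : ℤ) = 1 := by
    exact_mod_cast Literature.NumberTheory.EllipticCurves.ModularForms.det_eq_one' g
  rw [hdet, one_pow, one_mul]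
  ring

/-- Composition of the action: `(x ∘ g') ∘ g = x ∘ (g' g)`. [folklore] -/
theorem actV_actV (a b c d a' b' c' d' : ℝ) (x : V) :
    actV a b c d (actV a' b' c' d' x) =
      actV (a' * a + b' * c) (a' * b + b' * d) (c' * a + d' * c) (c' * b + d' * d) x := by
  ext i
  fin_cases i <;> simp [actV] <;> ring

/-- The identity acts trivially. [folklore] -/
theorem actV_id (x : V) : actV 1 0 0 1 x = x := by
  ext i
  fin_cases i <;> simp [actV]

/-! ### The lattices `L♮ = {[64a, b, c]} ⊇ L = {[64a, 128b, c]}` in coordinates -/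

/-- `ι♮(k) = [64 k₀, k₁, k₂]`: the lattice `L♮` (it contains Tunnell's lattice `L` of forms
`64aX² + 128bXY + cY²` as `{128 ∣ k₁}` and appears on the Poisson side of the kernels). [folklore] -/
def latSharp (k : Fin 3 → ℤ) : V := !₂[64 * (k 0 : ℝ), (k 1 : ℝ), (k 2 : ℝ)]

/-- `ι(v) = [64 v₀, 128 v₁, v₂]`: the lattice `L`. [folklore] -/
def latFun (v : Fin 3 → ℤ) : V := !₂[64 * (v 0 : ℝ), 128 * (v 1 : ℝ), (v 2 : ℝ)]

/-- The inclusion `L ⊆ L♮` in coordinates: `v ↦ (v₀, 128v₁, v₂)`. [folklore] -/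
def embedSharp (v : Fin 3 → ℤ) : Fin 3 → ℤ := ![v 0, 128 * v 1, v 2]

/-- `latSharp_zero` (coordinate). [folklore] -/
@[simp] theorem latSharp_zero (k : Fin 3 → ℤ) : latSharp k 0 = 64 * (k 0 : ℝ) := by simp [latSharp]
/-- `latSharp_one` (coordinate). [folklore] -/
@[simp] theorem latSharp_one (k : Fin 3 → ℤ) : latSharp k 1 = (k 1 : ℝ) := by simp [latSharp]
/-- `latSharp_two` (coordinate). [folklore] -/
@[simp] theorem latSharp_two (k : Fin 3 → ℤ) : latSharp k 2 = (k 2 : ℝ) := by simp [latSharp]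
/-- `latFun_zero` (coordinate). [folklore] -/
@[simp] theorem latFun_zero (v : Fin 3 → ℤ) : latFun v 0 = 64 * (v 0 : ℝ) := by simp [latFun]
/-- `latFun_one` (coordinate). [folklore] -/
@[simp] theorem latFun_one (v : Fin 3 → ℤ) : latFun v 1 = 128 * (v 1 : ℝ) := by simp [latFun]
/-- `latFun_two` (coordinate). [folklore] -/
@[simp] theorem latFun_two (v : Fin 3 → ℤ) : latFun v 2 = (v 2 : ℝ) := by simp [latFun]
/-- `embedSharp_zero` (coordinate). [folklore] -/
@[simp] theorem embedSharp_zero (v : Fin 3 → ℤ) : embedSharp v 0 = v 0 := rfl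
/-- `embedSharp_one` (coordinate). [folklore] -/
@[simp] theorem embedSharp_one (v : Fin 3 → ℤ) : embedSharp v 1 = 128 * v 1 := rfl
/-- `embedSharp_two` (coordinate). [folklore] -/
@[simp] theorem embedSharp_two (v : Fin 3 → ℤ) : embedSharp v 2 = v 2 := rfl

/-- `latSharp_embedSharp` (auxiliary). [folklore] -/
theorem latSharp_embedSharp (v : Fin 3 → ℤ) : latSharp (embedSharp v) = latFun v := by
  ext i; fin_cases i <;> simp [latSharp, latFun, embedSharp]

/-- `embedSharp_injective` (auxiliary). [folklore] -/
theorem embedSharp_injective : Function.Injective embedSharp := by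
  intro v u h
  funext i
  fin_cases i
  · simpa using congrFun h 0
  · have := congrFun h 1; simp at this; exact this
  · simpa using congrFun h 2

/-- `latSharp_add` (auxiliary). [folklore] -/
theorem latSharp_add (k l : Fin 3 → ℤ) : latSharp (k + l) = latSharp k + latSharp l := by
  ext i; fin_cases i <;> simp [latSharp, mul_add]

/-- `latSharp_neg` (auxiliary). [folklore] -/
theorem latSharp_neg (k : Fin 3 → ℤ) : latSharp (-k) = -latSharp k := by
  ext i; fin_cases i <;> simp [latSharp]

/-- `latSharp_injective` (auxiliary). [folklore] -/
theorem latSharp_injective : Function.Injective latSharp := by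
  intro k l h
  funext i
  fin_cases i
  · have := congrArg (· 0) h; simp [latSharp] at this; exact_mod_cast this
  · have := congrArg (· 1) h; simp [latSharp] at this; exact_mod_cast this
  · have := congrArg (· 2) h; simp [latSharp] at this; exact_mod_cast this

/-- `disc ι♮(k) = k₁² - 256 k₀k₂`. [folklore] -/
theorem disc_latSharp (k : Fin 3 → ℤ) : disc (latSharp k) = ((k 1 ^ 2 - 256 * k 0 * k 2 : ℤ) : ℝ) := by
  simp only [disc, latSharp_zero, latSharp_one, latSharp_two]; push_cast; ring

/-- `‖k‖_∞ ≤ ‖ι♮ k‖`. [folklore] -/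
theorem abs_le_norm_latSharp (k : Fin 3 → ℤ) (i : Fin 3) : |(k i : ℝ)| ≤ ‖latSharp k‖ := by
  refine le_trans ?_ (abs_apply_le_norm (latSharp k) i)
  fin_cases i
  · show |((k 0 : ℤ) : ℝ)| ≤ |latSharp k 0|
    rw [latSharp_zero, abs_mul, abs_of_pos (by norm_num : (0 : ℝ) < 64)]
    nlinarith [abs_nonneg ((k 0 : ℤ) : ℝ)]
  · show |((k 1 : ℤ) : ℝ)| ≤ |latSharp k 1|
    rw [latSharp_one]
  · show |((k 2 : ℤ) : ℝ)| ≤ |latSharp k 2|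
    rw [latSharp_two]

/-! ### The action of `Γ₀(64)` on `L♮` in coordinates -/

/-- For `g = (a b; 64c' d)`: coordinates of `ι♮(k) ∘ g` in `L♮`. [folklore] -/
def actSharp (a b c' d : ℤ) (k : Fin 3 → ℤ) : Fin 3 → ℤ :=
  ![k 0 * a ^ 2 + k 1 * a * c' + 64 * k 2 * c' ^ 2,
    128 * k 0 * a * b + k 1 * (a * d + 64 * b * c') + 128 * k 2 * c' * d,
    64 * k 0 * b ^ 2 + k 1 * b * d + k 2 * d ^ 2]

/-- `ι♮(actSharp g k) = ι♮(k) ∘ g`. [folklore] -/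
theorem latSharp_actSharp (a b c' d : ℤ) (k : Fin 3 → ℤ) :
    latSharp (actSharp a b c' d k) = actV a b (64 * c') d (latSharp k) := by
  ext i
  fin_cases i <;> simp [latSharp, actV, actSharp] <;> ring

/-- Composition of the coordinate actions. [folklore] -/
theorem actSharp_actSharp (a b c' d a₁ b₁ c₁' d₁ : ℤ) (k : Fin 3 → ℤ) :
    actSharp a b c' d (actSharp a₁ b₁ c₁' d₁ k) =
      actSharp (a₁ * a + 64 * b₁ * c') (a₁ * b + b₁ * d) (c₁' * a + d₁ * c') (64 * c₁' * b + d₁ * d) k := by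
  apply latSharp_injective
  rw [latSharp_actSharp, latSharp_actSharp, latSharp_actSharp, actV_actV]
  congr 1 <;> push_cast <;> ring

/-- The identity acts trivially. [folklore] -/
theorem actSharp_one (k : Fin 3 → ℤ) : actSharp 1 0 0 1 k = k := by
  apply latSharp_injective
  rw [latSharp_actSharp]
  push_cast
  rw [mul_zero]
  exact actV_id _

/-- `k ↦ actSharp g k` is a bijection of `ℤ³` for `g = (a b; 64c' d)` of determinant `1`. [folklore] -/
def actSharpEquiv (a b c' d : ℤ) (hdet : a * d - 64 * b * c' = 1) : (Fin 3 → ℤ) ≃ (Fin 3 → ℤ) where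
  toFun := actSharp a b c' d
  invFun := actSharp d (-b) (-c') a
  left_inv k := by
    rw [actSharp_actSharp]
    have e1 : a * d + 64 * b * -c' = 1 := by linear_combination hdet
    have e2 : a * -b + b * a = 0 := by ring
    have e3 : c' * d + d * -c' = 0 := by ring
    have e4 : 64 * c' * -b + d * a = 1 := by linear_combination hdet
    rw [e1, e2, e3, e4, actSharp_one]
  right_inv k := by
    rw [actSharp_actSharp]
    have e1 : d * a + 64 * -b * c' = 1 := by linear_combination hdet
    have e2 : d * b + -b * d = 0 := by ring
    have e3 : -c' * a + a * c' = 0 := by ring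
    have e4 : 64 * -c' * b + a * d = 1 := by linear_combination hdet
    rw [e1, e2, e3, e4, actSharp_one]

/-- `actSharpEquiv_apply` (auxiliary). [folklore] -/
@[simp] theorem actSharpEquiv_apply (a b c' d : ℤ) (hdet : a * d - 64 * b * c' = 1) (k : Fin 3 → ℤ) :
    actSharpEquiv a b c' d hdet k = actSharp a b c' d k := rfl

/-! ### Generalized theta kernels: `𝒦[c, t](w, z) = (Im z)^{1/2} ∑_{k ∈ ℤ³} c(k) f_{w, t z}(ι♮ k)` -/

/-- A weight `c : ℤ³ → ℂ` is *bounded*. [folklore] -/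
def BddWeight (c : (Fin 3 → ℤ) → ℂ) : Prop := ∃ C : ℝ, ∀ k, ‖c k‖ ≤ C

/-- **Generalized Shintani theta kernel** on `L♮` with weight `c` and scale `t > 0`:
`𝒦[c, t](w, z) = (Im z)^{1/2} ∑_{k ∈ ℤ³} c(k) f_{w, t z}(ι♮(k))` (Shintani 1975, (2.1), the theta
series `θ(z, g)` attached to a Schwartz function and a lattice coset function, here written on the
fixed lattice `L♮` with an arbitrary bounded coefficient function). [cite: Shintani1975, §2 (2.1)] -/
def genKernel (c : (Fin 3 → ℤ) → ℂ) (t : ℝ) (ht : 0 < t) (w z : ℍ) : ℂ :=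
  (Real.sqrt z.im : ℂ) * ∑' k : Fin 3 → ℤ, c k * shintaniFn w (mulPos t ht z) (latSharp k)

/-- Decay of the summands: `‖c(k) f_{w,Z}(ι♮ k)‖ ≤ C' (1 + ‖k‖_∞)⁻⁴`. [folklore] -/
theorem norm_term_le {c : (Fin 3 → ℤ) → ℂ} (hc : BddWeight c) (w Z : ℍ) :
    ∃ C' : ℝ, ∀ k : Fin 3 → ℤ,
      ‖c k * shintaniFn w Z (latSharp k)‖ ≤ C' * (1 + ‖fun i ↦ (k i : ℝ)‖) ^ (-(4 : ℝ)) := by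
  obtain ⟨C, hC⟩ := hc
  obtain ⟨C₁, hC₁⟩ := exists_norm_shintaniFn_le w Z
  have hC0 : 0 ≤ C := le_trans (norm_nonneg _) (hC 0)
  have hC₁0 : 0 ≤ C₁ := by
    have := hC₁ 0
    have h1 : (1 + ‖(0 : V)‖) ^ (-(4 : ℝ)) = 1 := by simp
    rw [h1, mul_one] at this
    exact le_trans (norm_nonneg _) this
  refine ⟨C * C₁, fun k ↦ ?_⟩
  rw [norm_mul]
  have hk : ‖fun i ↦ (k i : ℝ)‖ ≤ ‖latSharp k‖ := by
    refine (pi_norm_le_iff_of_nonneg (norm_nonneg _)).mpr fun i ↦ ?_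
    rw [Real.norm_eq_abs]
    exact abs_le_norm_latSharp k i
  have hdec : (1 + ‖latSharp k‖) ^ (-(4 : ℝ)) ≤ (1 + ‖fun i ↦ (k i : ℝ)‖) ^ (-(4 : ℝ)) := by
    apply Real.rpow_le_rpow_of_nonpos (by positivity) (by linarith) (by norm_num)
  calc ‖c k‖ * ‖shintaniFn w Z (latSharp k)‖
      ≤ C * (C₁ * (1 + ‖latSharp k‖) ^ (-(4 : ℝ))) :=
        mul_le_mul (hC k) (hC₁ _) (norm_nonneg _) hC0
    _ ≤ C * (C₁ * (1 + ‖fun i ↦ (k i : ℝ)‖) ^ (-(4 : ℝ))) := by gcongr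
    _ = C * C₁ * (1 + ‖fun i ↦ (k i : ℝ)‖) ^ (-(4 : ℝ)) := by ring

open Literature.NumberTheory.LFunctions.Fourier (summable_one_add_norm_rpow_neg) in
/-- **Absolute convergence** of the generalized kernels. [folklore] -/
theorem summable_term {c : (Fin 3 → ℤ) → ℂ} (hc : BddWeight c) (w Z : ℍ) :
    Summable fun k : Fin 3 → ℤ ↦ c k * shintaniFn w Z (latSharp k) := by
  obtain ⟨C', hC'⟩ := norm_term_le hc w Z
  refine Summable.of_norm_bounded ((summable_one_add_norm_rpow_neg (ι := Fin 3) (b := 4)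
    (by norm_num)).mul_left C') hC'

/-! ### The `w`-law: weight `-2` under `Γ₀(64)` for invariant weights -/

/-- A weight is `Γ₀(64)`-invariant if it is constant along the coordinate action of every
`g = (a b; 64c' d)` of determinant `1`. [folklore] -/
def InvWeight (c : (Fin 3 → ℤ) → ℂ) : Prop :=
  ∀ a b c' d : ℤ, a * d - 64 * b * c' = 1 → ∀ k, c (actSharp a b c' d k) = c k

open scoped MatrixGroups in
/-- **Weight `-2` in `w`**: `𝒦[c,t](γw, z) (c_γ w + d_γ)² = 𝒦[c,t](w, z)` for `γ ∈ Γ₀(64)` and a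
`Γ₀(64)`-invariant bounded weight `c` (reindex `k ↦ actSharp γ k`, `f_{γw,Z}(x)(cw+d)² = f_{w,Z}(x∘γ)`).
[cite: Shintani1975, (2.12)] -/
theorem genKernel_sl_smul {c : (Fin 3 → ℤ) → ℂ} (hinv : InvWeight c)
    (t : ℝ) (ht : 0 < t) (γ : SL(2, ℤ)) (hγ : (64 : ℤ) ∣ γ 1 0) (w z : ℍ) :
    genKernel c t ht (γ • w) z * (((γ 1 0 : ℤ) : ℂ) * w + ((γ 1 1 : ℤ) : ℂ)) ^ 2 =
      genKernel c t ht w z := by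
  obtain ⟨c', hc'⟩ := hγ
  have hdet : (γ 0 0 : ℤ) * γ 1 1 - 64 * γ 0 1 * c' = 1 := by
    have := Literature.NumberTheory.EllipticCurves.ModularForms.det_eq_one' γ
    rw [hc'] at this
    linear_combination this
  unfold genKernel
  rw [mul_assoc, mul_comm (∑' k, _) _, ← mul_assoc, mul_assoc]
  congr 1
  rw [← tsum_mul_left]
  -- termwise: `(cw+d)² c(k) f_{γw}(ι♮ k) = c(k) f_w(ι♮(actSharp γ k))`, then reindex
  have hterm : ∀ k : Fin 3 → ℤ, (((γ 1 0 : ℤ) : ℂ) * w + ((γ 1 1 : ℤ) : ℂ)) ^ 2 *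
      (c k * shintaniFn (γ • w) (mulPos t ht z) (latSharp k)) =
      c (actSharp (γ 0 0) (γ 0 1) c' (γ 1 1) k) *
        shintaniFn w (mulPos t ht z) (latSharp (actSharp (γ 0 0) (γ 0 1) c' (γ 1 1) k)) := by
    intro k
    rw [hinv _ _ _ _ hdet k, latSharp_actSharp]
    have h := shintaniFn_sl_smul γ w (mulPos t ht z) (latSharp k)
    rw [hc'] at h ⊢
    have e64 : ((64 * c' : ℤ) : ℝ) = 64 * (c' : ℝ) := by push_cast; ring
    rw [e64] at h
    rw [h]; ring
  exact (tsum_congr hterm).trans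
    ((actSharpEquiv _ _ _ _ hdet).tsum_eq (fun k ↦ c k * shintaniFn w (mulPos t ht z) (latSharp k)))

/-! ### Real translations in `z` and oddness -/

/-- **`z ↦ z + u`**: `𝒦[c,t](w, u + z) = 𝒦[c_u,t](w, z)` with `c_u(k) = c(k) e(t u · disc ι♮(k))`.
[folklore] -/
theorem genKernel_vadd (c : (Fin 3 → ℤ) → ℂ) (t : ℝ) (ht : 0 < t) (u : ℝ) (w z : ℍ) :
    genKernel c t ht w (u +ᵥ z) =
      genKernel (fun k ↦ c k * cexp (2 * π * I * (t * u * disc (latSharp k)))) t ht w z := by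
  unfold genKernel
  have him : (u +ᵥ z).im = z.im := UpperHalfPlane.vadd_im u z
  rw [him]
  congr 1
  refine tsum_congr fun k ↦ ?_
  have hpt : mulPos t ht (u +ᵥ z) = (t * u) +ᵥ mulPos t ht z := by
    apply UpperHalfPlane.ext
    simp only [coe_mulPos, UpperHalfPlane.coe_vadd]
    push_cast; ring
  rw [hpt, shintaniFn_vadd]
  push_cast
  ring

/-- **Integral periods**: if `t u disc ι♮(k) ∈ ℤ` on the support of `c`, then
`𝒦[c,t](w, u + z) = 𝒦[c,t](w, z)`. [folklore] -/
theorem genKernel_vadd_of_int {c : (Fin 3 → ℤ) → ℂ} {t : ℝ} (ht : 0 < t) {u : ℝ}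
    (h : ∀ k, c k ≠ 0 → ∃ n : ℤ, t * u * disc (latSharp k) = n) (w z : ℍ) :
    genKernel c t ht w (u +ᵥ z) = genKernel c t ht w z := by
  rw [genKernel_vadd]
  unfold genKernel
  congr 1
  refine tsum_congr fun k ↦ ?_
  dsimp only
  by_cases hk : c k = 0
  · rw [hk]; simp
  · obtain ⟨n, hn⟩ := h k hk
    have hn' : (t : ℂ) * (u : ℂ) * (disc (latSharp k) : ℂ) = (n : ℂ) := by exact_mod_cast hn
    have : cexp (2 * π * I * ((t : ℂ) * (u : ℂ) * (disc (latSharp k) : ℂ))) = 1 := by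
      rw [hn', show 2 * (π : ℂ) * I * (n : ℂ) = n * (2 * π * I) by ring]
      exact Complex.exp_int_mul_two_pi_mul_I n
    rw [this, mul_one]

/-- **Oddness**: a weight with `c(-k) = s c(k)` gives `(1 + s) 𝒦[c,t] = 0` (since `f_{w,Z}` is odd);
in particular `𝒦[c,t] = 0` for even weights (`s = 1`). [folklore] -/
theorem genKernel_of_weight_neg {c : (Fin 3 → ℤ) → ℂ} (hc : BddWeight c) {s : ℂ}
    (hs : ∀ k, c (-k) = s * c k) (t : ℝ) (ht : 0 < t) (w z : ℍ) :
    (1 + s) * genKernel c t ht w z = 0 := by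
  unfold genKernel
  set F : (Fin 3 → ℤ) → ℂ := fun k ↦ c k * shintaniFn w (mulPos t ht z) (latSharp k) with hF
  have hsum : Summable F := summable_term hc w _
  have h1 : ∀ k, F (-k) = -(s * F k) := fun k ↦ by
    simp only [hF, hs k, latSharp_neg, shintaniFn_neg]
    ring
  have hneg : ∑' k, F k = -(s * ∑' k, F k) := by
    have e := (Equiv.neg (Fin 3 → ℤ)).tsum_eq F
    simp only [Equiv.neg_apply] at e
    calc ∑' k, F k = ∑' k, F (-k) := e.symm
      _ = ∑' k, -(s * F k) := tsum_congr h1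
      _ = -(s * ∑' k, F k) := by rw [tsum_neg, tsum_mul_left]
  have : (1 + s) * ∑' k, F k = 0 := by linear_combination hneg
  rw [mul_left_comm, this, mul_zero]

/-! ### Poisson summation over affine images of `ℤ³` under diagonal maps -/

section PoissonDiagonal

open MeasureTheory
open scoped FourierTransform RealInnerProductSpace

/-- The diagonal map `x ↦ (μ₀x₀, μ₁x₁, μ₂x₂)`. [folklore] -/
def dgLin (μ : Fin 3 → ℝ) : V →ₗ[ℝ] V := Matrix.toEuclideanLin (Matrix.diagonal μ)

/-- `dgLin_apply` (auxiliary). [folklore] -/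
theorem dgLin_apply (μ : Fin 3 → ℝ) (x : V) (i : Fin 3) : dgLin μ x i = μ i * x i := by
  simp [dgLin, Matrix.toLpLin_apply, Matrix.mulVec, Matrix.diagonal, dotProduct,
    Finset.sum_ite_eq]

/-- `det_dgLin` (auxiliary). [folklore] -/
theorem det_dgLin (μ : Fin 3 → ℝ) : LinearMap.det (dgLin μ) = μ 0 * μ 1 * μ 2 := by
  rw [dgLin]
  dsimp only [Matrix.toEuclideanLin]
  rw [Matrix.toLpLin_eq_toLin, LinearMap.det_toLin, Matrix.det_diagonal, Fin.prod_univ_three]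

/-- `⟪A v, A⁻¹ ξ⟫ = ⟪v, ξ⟫` for the diagonal `A`. [folklore] -/
theorem inner_dgLin (μ : Fin 3 → ℝ) (hμ : ∀ i, μ i ≠ 0) (v ξ : V) :
    ⟪dgLin μ v, dgLin (fun i ↦ (μ i)⁻¹) ξ⟫ = ⟪v, ξ⟫ := by
  rw [inner_eq_sum_three, inner_eq_sum_three]
  simp only [dgLin_apply]
  have h0 := hμ 0; have h1 := hμ 1; have h2 := hμ 2
  field_simp

/-- `‖u‖ ≤ ‖A u‖` when all `μ_i ≥ 1`. [folklore] -/
theorem norm_le_norm_dgLin {μ : Fin 3 → ℝ} (hμ : ∀ i, 1 ≤ μ i) (u : V) : ‖u‖ ≤ ‖dgLin μ u‖ := by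
  have h : ‖u‖ ^ 2 ≤ ‖dgLin μ u‖ ^ 2 := by
    rw [norm_sq_eq_sum_three, norm_sq_eq_sum_three, dgLin_apply, dgLin_apply, dgLin_apply]
    have e : ∀ i, u i ^ 2 ≤ (μ i * u i) ^ 2 := fun i ↦ by
      rw [mul_pow]
      have : 1 ≤ μ i ^ 2 := by nlinarith [hμ i]
      nlinarith [sq_nonneg (u i)]
    linarith [e 0, e 1, e 2]
  exact pow_le_pow_iff_left₀ (norm_nonneg _) (norm_nonneg _) two_ne_zero |>.mp h

/-- `‖m‖ ≤ M ‖A⁻¹ m‖` with `M = μ₀ + μ₁ + μ₂` (all `μ_i ≥ 1`). [folklore] -/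
theorem norm_le_mul_norm_dgLin_inv {μ : Fin 3 → ℝ} (hμ : ∀ i, 1 ≤ μ i) (ξ : V) :
    ‖ξ‖ ≤ (μ 0 + μ 1 + μ 2) * ‖dgLin (fun i ↦ (μ i)⁻¹) ξ‖ := by
  set M := μ 0 + μ 1 + μ 2 with hM
  have hM1 : 1 ≤ M := by linarith [hμ 0, hμ 1, hμ 2]
  have h : ‖ξ‖ ^ 2 ≤ (M * ‖dgLin (fun i ↦ (μ i)⁻¹) ξ‖) ^ 2 := by
    rw [mul_pow, norm_sq_eq_sum_three, norm_sq_eq_sum_three, dgLin_apply, dgLin_apply, dgLin_apply]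
    have e : ∀ i, ξ i ^ 2 ≤ M ^ 2 * ((μ i)⁻¹ * ξ i) ^ 2 := fun i ↦ by
      have hi : 0 < μ i := by linarith [hμ i]
      have hle : μ i ≤ M := by
        rw [hM]; fin_cases i <;> simp <;> linarith [hμ 0, hμ 1, hμ 2]
      rw [mul_pow, inv_pow, ← mul_assoc]
      have : 1 ≤ M ^ 2 * (μ i ^ 2)⁻¹ := by
        rw [le_mul_inv_iff₀ (by positivity), one_mul]
        exact pow_le_pow_left₀ hi.le hle 2
      nlinarith [sq_nonneg (ξ i)]
    nlinarith [e 0, e 1, e 2]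
  have := pow_le_pow_iff_left₀ (norm_nonneg ξ) (by positivity) two_ne_zero |>.mp h
  exact this

open Literature.NumberTheory.LFunctions.Fourier (tsum_eq_tsum_fourier_intLattice
  summable_one_add_norm_rpow_neg) in
/-- **Poisson summation for `f_{w,Z}` over `A(ℤ³) + h`**, `A = diag(μ)` with `μ_i ≥ 1`:
`∑_{q ∈ ℤ³} f_{w,Z}(Aq + h) = (μ₀μ₁μ₂)⁻¹ ∑_{m ∈ ℤ³} e(⟪h, A⁻¹m⟫) κ(Z) f_{w,-1/(4Z)}(S⁻¹A⁻¹m)`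
(the tree's Poisson formula on `ℤ³` for `f_{w,Z} ∘ (A · + h)`, `Shintani.fourier_shintaniFn`,
`Shintani.fourier_comp_linearMap`). [cite: Shintani1975, Prop. 1.6] -/
theorem tsum_shintaniFn_diag {μ : Fin 3 → ℝ} (hμ : ∀ i, 1 ≤ μ i) (h : V) (w Z : ℍ) :
    ∑' q : Fin 3 → ℤ, shintaniFn w Z (dgLin μ (WithLp.toLp 2 fun i ↦ (q i : ℝ)) + h) =
      ((μ 0 * μ 1 * μ 2)⁻¹ : ℝ) • ∑' m : Fin 3 → ℤ,
        𝐞 (⟪h, dgLin (fun i ↦ (μ i)⁻¹) (WithLp.toLp 2 fun i ↦ (m i : ℝ))⟫) •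
          (kappa Z * shintaniFn w (invFour Z)
            (sinv (dgLin (fun i ↦ (μ i)⁻¹) (WithLp.toLp 2 fun i ↦ (m i : ℝ))))) := by
  have hμ0 : ∀ i, μ i ≠ 0 := fun i ↦ by linarith [hμ i]
  have hdet : LinearMap.det (dgLin μ) ≠ 0 := by
    rw [det_dgLin]; exact mul_ne_zero (mul_ne_zero (hμ0 0) (hμ0 1)) (hμ0 2)
  have hdetpos : 0 < μ 0 * μ 1 * μ 2 :=
    mul_pos (mul_pos (by linarith [hμ 0]) (by linarith [hμ 1])) (by linarith [hμ 2])
  set F : V → ℂ := fun u ↦ shintaniFn w Z (dgLin μ u + h) with hF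
  -- continuity
  have hFc : Continuous F := by
    rw [hF]
    exact (continuous_shintaniFn w Z).comp
      (((dgLin μ).continuous_of_finiteDimensional).add continuous_const)
  -- decay
  obtain ⟨C, hC⟩ := exists_norm_shintaniFn_le w Z
  have hC0 : 0 ≤ C := by
    have := hC 0
    have h1 : (1 + ‖(0 : V)‖) ^ (-(4 : ℝ)) = 1 := by simp
    rw [h1, mul_one] at this
    exact le_trans (norm_nonneg _) this
  have hFdec : ∀ u, ‖F u‖ ≤ C * (1 + ‖h‖) ^ 4 * (1 + ‖u‖) ^ (-(4 : ℝ)) := fun u ↦ by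
    have hmono : (1 + ‖dgLin μ u‖) ^ (-(4 : ℝ)) ≤ (1 + ‖u‖) ^ (-(4 : ℝ)) :=
      Real.rpow_le_rpow_of_nonpos (by positivity)
        (by linarith [norm_le_norm_dgLin hμ u]) (by norm_num)
    calc ‖F u‖ = ‖shintaniFn w Z (dgLin μ u + h)‖ := rfl
      _ ≤ C * (1 + ‖dgLin μ u + h‖) ^ (-(4 : ℝ)) := hC _
      _ ≤ C * ((1 + ‖h‖) ^ 4 * (1 + ‖dgLin μ u‖) ^ (-(4 : ℝ))) :=
          mul_le_mul_of_nonneg_left (decay_translate _ _) hC0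
      _ ≤ C * ((1 + ‖h‖) ^ 4 * (1 + ‖u‖) ^ (-(4 : ℝ))) :=
          mul_le_mul_of_nonneg_left (mul_le_mul_of_nonneg_left hmono (by positivity)) hC0
      _ = C * (1 + ‖h‖) ^ 4 * (1 + ‖u‖) ^ (-(4 : ℝ)) := by ring
  -- the Fourier transform of `F`
  set B : V → V := fun ξ ↦ dgLin (fun i ↦ (μ i)⁻¹) ξ with hB
  have hFourier : ∀ ξ : V, 𝓕 F ξ = |(μ 0 * μ 1 * μ 2)⁻¹| •
      (𝐞 (⟪h, B ξ⟫) • (kappa Z * shintaniFn w (invFour Z) (sinv (B ξ)))) := by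
    intro ξ
    have h1 : F = (fun x ↦ shintaniFn w Z (x + h)) ∘ (dgLin μ) := rfl
    rw [h1, fourier_comp_linearMap (dgLin μ) hdet B (inner_dgLin μ hμ0) _ ξ, det_dgLin]
    congr 1
    have := congrFun (VectorFourier.fourierIntegral_comp_add_right 𝐞 volume (innerₗ V)
      (shintaniFn w Z) h) (B ξ)
    change 𝓕 (fun x ↦ shintaniFn w Z (x + h)) (B ξ) = _ at this
    rw [this, innerₗ_apply_apply]
    change (𝐞 ⟪h, B ξ⟫) • 𝓕 (shintaniFn w Z) (B ξ) = _
    rw [fourier_shintaniFn]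
  -- summability of the Fourier side over `ℤ³`
  set M : ℝ := μ 0 + μ 1 + μ 2 with hM
  have hM1 : 1 ≤ M := by linarith [hμ 0, hμ 1, hμ 2]
  obtain ⟨C', hC'⟩ := exists_norm_shintaniFn_le w (invFour Z)
  have hC'0 : 0 ≤ C' := by
    have := hC' 0
    have h1 : (1 + ‖(0 : V)‖) ^ (-(4 : ℝ)) = 1 := by simp
    rw [h1, mul_one] at this
    exact le_trans (norm_nonneg _) this
  have hbound : ∀ m : Fin 3 → ℤ, ‖𝓕 F (WithLp.toLp 2 fun i ↦ (m i : ℝ))‖ ≤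
      |(μ 0 * μ 1 * μ 2)⁻¹| * ‖kappa Z‖ * C' * (2 * M) ^ 4 *
        (1 + ‖fun i ↦ (m i : ℝ)‖) ^ (-(4 : ℝ)) := by
    intro m
    set ξ : V := WithLp.toLp 2 fun i ↦ (m i : ℝ) with hξ
    rw [hFourier, norm_smul, Real.norm_eq_abs, abs_abs, Circle.norm_smul, norm_mul]
    have hdec : (1 + ‖sinv (B ξ)‖) ^ (-(4 : ℝ)) ≤ (2 * M) ^ 4 * (1 + ‖fun i ↦ (m i : ℝ)‖) ^ (-(4 : ℝ)) := by
      refine rpow_neg_four_le (by positivity) (by positivity) ?_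
      have h1 : ‖fun i ↦ (m i : ℝ)‖ ≤ ‖ξ‖ := by
        refine (pi_norm_le_iff_of_nonneg (norm_nonneg _)).mpr fun i ↦ ?_
        rw [Real.norm_eq_abs]
        have := abs_apply_le_norm ξ i
        rw [hξ] at this ⊢
        simpa using this
      have h2 : ‖ξ‖ ≤ M * ‖B ξ‖ := norm_le_mul_norm_dgLin_inv hμ ξ
      have h3 : ‖B ξ‖ ≤ 2 * ‖sinv (B ξ)‖ := norm_le_two_mul_norm_sinv _
      have hM0 : 0 ≤ M := by linarith
      nlinarith [h1, h2, h3, norm_nonneg (sinv (B ξ)), mul_nonneg hM0 (norm_nonneg (sinv (B ξ)))]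
    calc |(μ 0 * μ 1 * μ 2)⁻¹| * (‖kappa Z‖ * ‖shintaniFn w (invFour Z) (sinv (B ξ))‖)
        ≤ |(μ 0 * μ 1 * μ 2)⁻¹| * (‖kappa Z‖ * (C' * (1 + ‖sinv (B ξ)‖) ^ (-(4 : ℝ)))) := by
          gcongr; exact hC' _
      _ ≤ |(μ 0 * μ 1 * μ 2)⁻¹| * (‖kappa Z‖ * (C' * ((2 * M) ^ 4 *
          (1 + ‖fun i ↦ (m i : ℝ)‖) ^ (-(4 : ℝ))))) := by gcongr
      _ = _ := by ring
  have hsum : Summable fun m : Fin 3 → ℤ ↦ 𝓕 F (WithLp.toLp 2 fun i ↦ (m i : ℝ)) :=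
    Summable.of_norm_bounded ((summable_one_add_norm_rpow_neg (ι := Fin 3) (b := 4)
      (by norm_num)).mul_left _) hbound
  -- Poisson on `ℤ³`
  have hb : (Fintype.card (Fin 3) : ℝ) < 4 := by norm_num
  have key := tsum_eq_tsum_fourier_intLattice hFc hb hFdec hsum
  have hAbs : |(μ 0 * μ 1 * μ 2)⁻¹| = (μ 0 * μ 1 * μ 2)⁻¹ := abs_of_pos (inv_pos.mpr hdetpos)
  rw [key, tsum_congr (fun m ↦ hFourier _), hAbs]
  simp only [Complex.real_smul]
  exact tsum_mul_left

end PoissonDiagonal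

end Literature.NumberTheory.EllipticCurves.Shintani
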